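import Literature.AlgebraicGeometry.Deformation.SmoothSchemeLiftObstructionFunctorialCech
import Literature.AlgebraicGeometry.Modules.DualFrameEvaluation
import Literature.AlgebraicGeometry.AbelianSchemes.GlobalOneFormsMulNOfAbelianSchemeOver
import Literature.AlgebraicGeometry.Morphisms.CechModuleUnitH2Pullback
import Literature.AlgebraicGeometry.Morphisms.CechModuleH2RefinementLemmas
import HarnessLib

/-!
# Slot rel₁ of the F-11 ∕ J4-(iv) obstruction calculus, DISCHARGED: `[([2]^*(π_a o^X))|_W] = 2 • [(π_a o^Y)|_W]`

Cell hodgecm-mathlib (D-0151), cert v1 of B-p03 (g21) for the rel₁ row (F0P1b-plan (R95)(2), (R108)): the composite of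

* ★ p799378 `Deformation.exists_cechMD1_eq_comap_obstruction_sub` (B-p08 (g16), FILE B2: Čech functoriality of the
  obstruction cochain per global `1`-form) at `Y := X := B.X`, `f := [2] = B.mulN 2`, `ω' := ω`, `M := 2`;
* ★ p798008 `AbelianSchemeOver.comap_mulN_app_top_algebraMap` (`[2]^*ω = 2 • ω` on global `1`-forms) — B2's `hω`;
* ★ p799127 `AbelianSchemeOver.exists_oneForm_tangentSheaf_hom_app_eq_of_isLocalRing` (every module map
  `π_a : 𝒯 → 𝒪` is evaluation at a global `1`-form) — the dictionary, for an ARBITRARY `π_a`;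
* the refinement∕class algebra `slot3_rel1_of_B2` (v0 cert a74a275512b3a913, reproduced below).

HEAD `cechMH2_mk_refine_comap_mulN_two_map_eq_two_smul`: under B2's deformation hypotheses on the cover pair
`(U, U' = [2]⁻¹U)` (lifted gluing data `ψ^X, ψ^Y`, obstruction cochains `o^X, o^Y` with their ★ F2 characterisations
AND their cocycle facts, chart lifts `F_j` of `[2]♯`), for EVERY module map `π_a : 𝒯_X → 𝒪_X` and every refinement
`W →_{τ'} [2]⁻¹U`:  `[ref_{τ'}([2]^*(π_a o^X))] = (2 : k) • [ref_{τ'}(π_a o^Y)]` in `Ȟ²(W, 𝒪_X)` — the rel₁ conjunct of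
B-p14 (g21)'s `hrel₁₂` (socket cert 6048a61d :304) with the witness `q := ref_{τ'}(π_a o^Y)`.
HOME-only unless the planner says otherwise; HC_CM is proved only modulo the 7 printed citations until rung 0 closes.

## References

* D. Mumford, *Abelian Varieties* (1970), §4 (iv) (pp. 42–43): `[n]^* = n` on invariant `1`-forms. [MumfordAV1970]
* R. Hartshorne, *Deformation Theory* (2010), Thm. 10.2 (proof), p. 81; Cor. 10.3, p. 82. [Hartshorne2010]
* R. Hartshorne, *Algebraic Geometry* (1977), II Ex. 5.1 (a) (p. 123). [Hartshorne1977]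
-/

set_option backward.isDefEq.respectTransparency false

noncomputable section

open CategoryTheory AlgebraicGeometry Opposite TopologicalSpace
open scoped TensorProduct

namespace Literature.AlgebraicGeometry.AbelianSchemes.AbelianSchemeOver

open Literature.AlgebraicGeometry.Motives Literature.AlgebraicGeometry.HodgeTheory Literature.AlgebraicGeometry.Modules
open Literature.AlgebraicGeometry.Morphisms Literature.AlgebraicGeometry.Deformation


variable {k : Type} [Field k] (B : AbelianSchemeOver (Spec (.of k)))

/-- **slot (3) `rel₁` from the B2 letter** (cochain identity on `[2]⁻¹U` ⟹ class identity on the common refinement `W`).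
(No `halg` needed: `algebraMap k _ 2 = 2` for any algebra structure.)  Hypotheses: `hπω` = the dictionary «`π.app V θ = θ_V(ω|_V)`» for ONE frame projection `π : 𝒯_X ⟶ 𝒪_X` and its global `1`-form `ω`;
`hB2` = the B2 conclusion at `(f, ω', M) := ([2], ω, 2)` on the cover pair `(U, [2]⁻¹U)`.
[cite: MumfordAV1970, §4 (iv) (p. 42–43)] [cite: Hartshorne2010, Thm. 10.2 (proof), p. 81] -/
theorem slot3_rel1_of_B2 [∀ W : B.X.left.Opens, Algebra k Γ(B.X.left, W)]
    {ι : Type} (U : ι → B.X.left.affineOpens)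
    {κ : Type} (W : κ → B.X.left.Opens) (τ' : κ → ι) (hτ' : ∀ s, W s ≤ (B.mulN 2).left ⁻¹ᵁ (U (τ' s)).1)
    (π : tangentSheaf B.X ⟶ SheafOfModules.unit B.X.left.ringCatSheaf) (ω : Γ(cotangentSheaf B.X, ⊤))
    (hπω : ∀ (V : B.X.left.Opens) (θ : Γ(tangentSheaf B.X, V)),
      π.app V θ = appLE θ (𝟙 V) ((cotangentSheaf B.X).presheaf.map (homOfLE (le_top : V ≤ ⊤)).op ω))
    (o : CechMC2 B.X.hom (tangentSheaf B.X) (fun j => (U j).1)) (ho : o ∈ cechMZ2 B.X.hom (tangentSheaf B.X) (fun j => (U j).1))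
    (o' : CechMC2 B.X.hom (tangentSheaf B.X) (preimageFamily (B.mulN 2).left (fun j => (U j).1)))
    (ho' : o' ∈ cechMZ2 B.X.hom (tangentSheaf B.X) (preimageFamily (B.mulN 2).left (fun j => (U j).1)))
    (hB2 : ∃ ε : CechMC1 B.X.hom (SheafOfModules.unit B.X.left.ringCatSheaf) (preimageFamily (B.mulN 2).left (fun j => (U j).1)),
      ∀ j l m : ι,
        (B.mulN 2).left.appLE ((U j).1 ⊓ (U l).1 ⊓ (U m).1)
            ((B.mulN 2).left ⁻¹ᵁ (U j).1 ⊓ (B.mulN 2).left ⁻¹ᵁ (U l).1 ⊓ (B.mulN 2).left ⁻¹ᵁ (U m).1) (fun _ hx => hx)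
            (show Γ(B.X.left, (U j).1 ⊓ (U l).1 ⊓ (U m).1) from
              appLE (o j l m) (𝟙 _) ((cotangentSheaf B.X).presheaf.map (homOfLE le_top).op ω)) -
          algebraMap k Γ(B.X.left, (B.mulN 2).left ⁻¹ᵁ (U j).1 ⊓ (B.mulN 2).left ⁻¹ᵁ (U l).1 ⊓ (B.mulN 2).left ⁻¹ᵁ (U m).1)
              (2 : k) *
            (show Γ(B.X.left, (B.mulN 2).left ⁻¹ᵁ (U j).1 ⊓ (B.mulN 2).left ⁻¹ᵁ (U l).1 ⊓ (B.mulN 2).left ⁻¹ᵁ (U m).1) from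
              appLE (o' j l m) (𝟙 _) ((cotangentSheaf B.X).presheaf.map (homOfLE le_top).op ω)) =
        (show Γ(B.X.left, (B.mulN 2).left ⁻¹ᵁ (U j).1 ⊓ (B.mulN 2).left ⁻¹ᵁ (U l).1 ⊓ (B.mulN 2).left ⁻¹ᵁ (U m).1) from
          cechMD1 B.X.hom (SheafOfModules.unit B.X.left.ringCatSheaf) (preimageFamily (B.mulN 2).left (fun j => (U j).1)) ε j l m)) :
    CechMH2.mk B.X.hom (SheafOfModules.unit B.X.left.ringCatSheaf) W
        ⟨cechMRefineC2 B.X.hom _ (preimageFamily (B.mulN 2).left (fun j => (U j).1)) W τ' hτ'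
            (cechComapC2 B.X.hom B.X.hom (B.mulN 2).left (Over.w (B.mulN 2)) (fun j => (U j).1)
              (cechMapC2 B.X.hom π _ o)),
          refineMC2_mem_cechMZ2 B.X.hom _ _ W τ' hτ'
            (comapC2_mem_cechMZ2 B.X.hom B.X.hom (B.mulN 2).left (Over.w (B.mulN 2)) (fun j => (U j).1)
              (mapC2_mem_cechMZ2 B.X.hom π _ ho))⟩ =
      (2 : k) • CechMH2.mk B.X.hom (SheafOfModules.unit B.X.left.ringCatSheaf) W
        ⟨cechMRefineC2 B.X.hom _ (preimageFamily (B.mulN 2).left (fun j => (U j).1)) W τ' hτ' (cechMapC2 B.X.hom π _ o'),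
          refineMC2_mem_cechMZ2 B.X.hom _ _ W τ' hτ' (mapC2_mem_cechMZ2 B.X.hom π _ ho')⟩ := by
  obtain ⟨ε, hε⟩ := hB2
  -- the cochain identity on `[2]⁻¹U`, in the module Čech currency
  have hcoch : (show CechMC2 B.X.hom (SheafOfModules.unit B.X.left.ringCatSheaf) (preimageFamily (B.mulN 2).left (fun j => (U j).1))
        from cechComapC2 B.X.hom B.X.hom (B.mulN 2).left (Over.w (B.mulN 2)) (fun j => (U j).1)
          (cechMapC2 B.X.hom π _ o)) -
      (2 : k) • cechMapC2 B.X.hom π _ o' =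
      cechMD1 B.X.hom (SheafOfModules.unit B.X.left.ringCatSheaf) (preimageFamily (B.mulN 2).left (fun j => (U j).1)) ε := by
    funext j l m
    have h := hε j l m
    dsimp only at h
    -- B2's two values are `π`'s values by the dictionary; `algebraMap 2 = 2`
    rw [← hπω, ← hπω, map_ofNat, two_mul] at h
    change (show MSections B.X.hom (SheafOfModules.unit B.X.left.ringCatSheaf) _ from
        (cechComapC2 B.X.hom B.X.hom (B.mulN 2).left (Over.w (B.mulN 2)) (fun j => (U j).1)
          (cechMapC2 B.X.hom π _ o)) j l m) - (2 : k) • (cechMapC2 B.X.hom π _ o') j l m = _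
    rw [cechComapC2_apply, cechMapC2_apply, cechMapC2_apply, MSections.app_apply, MSections.app_apply, two_smul]
    exact h
  -- refine along `τ'` and pass to classes
  rw [← map_smul, CechMH2.mk_eq_mk_iff]
  change cechMRefineC2 B.X.hom _ _ W τ' hτ' _ - (2 : k) • cechMRefineC2 B.X.hom _ _ W τ' hτ' _ ∈ _
  rw [← map_smul, ← map_sub, hcoch]
  exact refineMC2_mem_cechMB2 B.X.hom _ _ W τ' hτ' ((mem_cechMB2_iff B.X.hom _ _ _).mpr ⟨ε, rfl⟩)

/-- **rel₁, discharged (B2 ∘ dictionary ∘ `[2]^* = 2`)**: for an abelian scheme `B` of relative dimension `g`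
over a field, B2's deformation data on the cover pair `(U, U' = [2]⁻¹U)`, the cocycle facts of the two obstruction
cochains, ANY module map `π_a : 𝒯 → 𝒪` and any refinement `W →_{τ'} [2]⁻¹U`:
`[ref_{τ'}([2]^*(π_a o^X))] = (2 : k) • [ref_{τ'}(π_a o^Y)]` in `Ȟ²(W, 𝒪)`.
[cite: MumfordAV1970, §4 (iv) (p. 42–43)] [cite: Hartshorne2010, Thm. 10.2 (proof), p. 81] [cite: Hartshorne1977, II Ex. 5.1 (a) (p. 123)] -/
theorem cechMH2_mk_refine_comap_mulN_two_map_eq_two_smul [∀ W : B.X.left.Opens, Algebra k Γ(B.X.left, W)]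
    (halg : ∀ (W : B.X.left.Opens) (s : k), algebraMap k Γ(B.X.left, W) s = (constToPresheaf B.X).app (op W) s)
    {g : ℕ} (hA : B.IsOfRelDim g)
    {A' : Type} [CommRing A'] [Algebra k A'] (J 𝔫' : Ideal A') (hJ : J * J = ⊥) (hJ𝔫 : J * 𝔫' = ⊥)
    (h𝔫 : IsNilpotent 𝔫') (e : ↥(J.restrictScalars k) ≃ₗ[k] k)
    {ι : Type} (U : ι → B.X.left.affineOpens) (b : (j l : ι) → Γ(B.X.left, (U j).1))
    (hb : ∀ j l, (U j).1 ⊓ (U l).1 = B.X.left.basicOpen (b j l))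
    (U' : ι → B.X.left.affineOpens) (hU' : ∀ j, (U' j).1 = (B.mulN 2).left ⁻¹ᵁ (U j).1)
    (ψX : (j l : ι) → A' ⊗[k] Γ(B.X.left, (U j).1 ⊓ (U l).1) ≃ₐ[A'] A' ⊗[k] Γ(B.X.left, (U j).1 ⊓ (U l).1))
    (hψX : ∀ j l x, ψX j l x - x ∈ 𝔫' • (⊤ : Submodule A' (A' ⊗[k] Γ(B.X.left, (U j).1 ⊓ (U l).1))))
    (ψY : (j l : ι) → A' ⊗[k] Γ(B.X.left, (U' j).1 ⊓ (U' l).1) ≃ₐ[A'] A' ⊗[k] Γ(B.X.left, (U' j).1 ⊓ (U' l).1))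
    (hψY : ∀ j l x, ψY j l x - x ∈ 𝔫' • (⊤ : Submodule A' (A' ⊗[k] Γ(B.X.left, (U' j).1 ⊓ (U' l).1))))
    (oX : CechMC2 B.X.hom (tangentSheaf B.X) (fun j => (U j).1))
    (hoX : ∀ (j l m : ι)
      (Φjl : A' ⊗[k] Γ(B.X.left, (U j).1 ⊓ (U l).1) →ₐ[A'] A' ⊗[k] Γ(B.X.left, (U j).1 ⊓ (U l).1 ⊓ (U m).1))
      (_ : ∀ a s, Φjl (a ⊗ₜ s) = a ⊗ₜ B.X.left.presheaf.map (homOfLE inf_le_left).op s)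
      (Φlm : A' ⊗[k] Γ(B.X.left, (U l).1 ⊓ (U m).1) →ₐ[A'] A' ⊗[k] Γ(B.X.left, (U j).1 ⊓ (U l).1 ⊓ (U m).1))
      (_ : ∀ a s, Φlm (a ⊗ₜ s) = a ⊗ₜ B.X.left.presheaf.map
        (homOfLE (le_inf (inf_le_left.trans inf_le_right) inf_le_right)).op s)
      (Φjm : A' ⊗[k] Γ(B.X.left, (U j).1 ⊓ (U m).1) →ₐ[A'] A' ⊗[k] Γ(B.X.left, (U j).1 ⊓ (U l).1 ⊓ (U m).1))
      (_ : ∀ a s, Φjm (a ⊗ₜ s) = a ⊗ₜ B.X.left.presheaf.map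
        (homOfLE (le_inf (inf_le_left.trans inf_le_left) inf_le_right)).op s)
      (ρjl ρlm ρjm : A' ⊗[k] Γ(B.X.left, (U j).1 ⊓ (U l).1 ⊓ (U m).1) ≃ₐ[A']
        A' ⊗[k] Γ(B.X.left, (U j).1 ⊓ (U l).1 ⊓ (U m).1)),
      (∀ x, ρjl (Φjl x) = Φjl (ψX j l x)) → (∀ x, ρlm (Φlm x) = Φlm (ψX l m x)) →
      (∀ x, ρjm (Φjm x) = Φjm (ψX j m x)) →
      ∀ c : Γ(B.X.left, (U j).1 ⊓ (U l).1 ⊓ (U m).1), (ρlm * ρjl * ρjm⁻¹) ((1 : A') ⊗ₜ c) =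
        (1 : A') ⊗ₜ c + ((e.symm 1 : ↥(J.restrictScalars k)) : A') ⊗ₜ
          (show Γ(B.X.left, (U j).1 ⊓ (U l).1 ⊓ (U m).1) from appLE (oX j l m) (𝟙 _) (dSection B.X _ c)))
    (oY : CechMC2 B.X.hom (tangentSheaf B.X) (fun j => (U' j).1))
    (hoY : ∀ (j l m : ι)
      (Φjl : A' ⊗[k] Γ(B.X.left, (U' j).1 ⊓ (U' l).1) →ₐ[A'] A' ⊗[k] Γ(B.X.left, (U' j).1 ⊓ (U' l).1 ⊓ (U' m).1))
      (_ : ∀ a s, Φjl (a ⊗ₜ s) = a ⊗ₜ B.X.left.presheaf.map (homOfLE inf_le_left).op s)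
      (Φlm : A' ⊗[k] Γ(B.X.left, (U' l).1 ⊓ (U' m).1) →ₐ[A'] A' ⊗[k] Γ(B.X.left, (U' j).1 ⊓ (U' l).1 ⊓ (U' m).1))
      (_ : ∀ a s, Φlm (a ⊗ₜ s) = a ⊗ₜ B.X.left.presheaf.map
        (homOfLE (le_inf (inf_le_left.trans inf_le_right) inf_le_right)).op s)
      (Φjm : A' ⊗[k] Γ(B.X.left, (U' j).1 ⊓ (U' m).1) →ₐ[A'] A' ⊗[k] Γ(B.X.left, (U' j).1 ⊓ (U' l).1 ⊓ (U' m).1))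
      (_ : ∀ a s, Φjm (a ⊗ₜ s) = a ⊗ₜ B.X.left.presheaf.map
        (homOfLE (le_inf (inf_le_left.trans inf_le_left) inf_le_right)).op s)
      (ρjl ρlm ρjm : A' ⊗[k] Γ(B.X.left, (U' j).1 ⊓ (U' l).1 ⊓ (U' m).1) ≃ₐ[A']
        A' ⊗[k] Γ(B.X.left, (U' j).1 ⊓ (U' l).1 ⊓ (U' m).1)),
      (∀ x, ρjl (Φjl x) = Φjl (ψY j l x)) → (∀ x, ρlm (Φlm x) = Φlm (ψY l m x)) →
      (∀ x, ρjm (Φjm x) = Φjm (ψY j m x)) →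
      ∀ c : Γ(B.X.left, (U' j).1 ⊓ (U' l).1 ⊓ (U' m).1), (ρlm * ρjl * ρjm⁻¹) ((1 : A') ⊗ₜ c) =
        (1 : A') ⊗ₜ c + ((e.symm 1 : ↥(J.restrictScalars k)) : A') ⊗ₜ
          (show Γ(B.X.left, (U' j).1 ⊓ (U' l).1 ⊓ (U' m).1) from appLE (oY j l m) (𝟙 _) (dSection B.X _ c)))
    (F : (j : ι) → A' ⊗[k] Γ(B.X.left, (U j).1) →ₐ[A'] A' ⊗[k] Γ(B.X.left, (U' j).1))
    (hF : ∀ j (c : Γ(B.X.left, (U j).1)),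
      F j ((1 : A') ⊗ₜ c) - (1 : A') ⊗ₜ (B.mulN 2).left.appLE (U j).1 (U' j).1 (hU' j).le c ∈
        𝔫' • (⊤ : Submodule A' (A' ⊗[k] Γ(B.X.left, (U' j).1))))
    (hFψ : ∀ (j l : ι)
      (ΦXj : A' ⊗[k] Γ(B.X.left, (U j).1) →ₐ[A'] A' ⊗[k] Γ(B.X.left, (U j).1 ⊓ (U l).1))
      (_ : ∀ a s, ΦXj (a ⊗ₜ s) = a ⊗ₜ B.X.left.presheaf.map (homOfLE inf_le_left).op s)
      (ΦXl : A' ⊗[k] Γ(B.X.left, (U l).1) →ₐ[A'] A' ⊗[k] Γ(B.X.left, (U j).1 ⊓ (U l).1))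
      (_ : ∀ a s, ΦXl (a ⊗ₜ s) = a ⊗ₜ B.X.left.presheaf.map (homOfLE inf_le_right).op s)
      (ΦYj : A' ⊗[k] Γ(B.X.left, (U' j).1) →ₐ[A'] A' ⊗[k] Γ(B.X.left, (U' j).1 ⊓ (U' l).1))
      (_ : ∀ a s, ΦYj (a ⊗ₜ s) = a ⊗ₜ B.X.left.presheaf.map (homOfLE inf_le_left).op s)
      (ΦYl : A' ⊗[k] Γ(B.X.left, (U' l).1) →ₐ[A'] A' ⊗[k] Γ(B.X.left, (U' j).1 ⊓ (U' l).1))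
      (_ : ∀ a s, ΦYl (a ⊗ₜ s) = a ⊗ₜ B.X.left.presheaf.map (homOfLE inf_le_right).op s)
      (Fj Fl : A' ⊗[k] Γ(B.X.left, (U j).1 ⊓ (U l).1) →ₐ[A'] A' ⊗[k] Γ(B.X.left, (U' j).1 ⊓ (U' l).1)),
      (∀ x, Fj (ΦXj x) = ΦYj (F j x)) → (∀ x, Fl (ΦXl x) = ΦYl (F l x)) →
      ∀ c : Γ(B.X.left, (U j).1 ⊓ (U l).1),
        Fl (ψX j l ((1 : A') ⊗ₜ c)) - ψY j l (Fj ((1 : A') ⊗ₜ c)) ∈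
          J • (⊤ : Submodule A' (A' ⊗[k] Γ(B.X.left, (U' j).1 ⊓ (U' l).1))))
    (hoXZ : oX ∈ cechMZ2 B.X.hom (tangentSheaf B.X) (fun j => (U j).1))
    (hoYZ : oY ∈ cechMZ2 B.X.hom (tangentSheaf B.X) (fun j => (U' j).1))
    (πa : tangentSheaf B.X ⟶ SheafOfModules.unit B.X.left.ringCatSheaf)
    {κ : Type} (W : κ → B.X.left.Opens) (τ' : κ → ι) (hτ' : ∀ s, W s ≤ (B.mulN 2).left ⁻¹ᵁ (U (τ' s)).1) :
    CechMH2.mk B.X.hom (SheafOfModules.unit B.X.left.ringCatSheaf) W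
        ⟨cechMRefineC2 B.X.hom _ (preimageFamily (B.mulN 2).left (fun j => (U j).1)) W τ' hτ'
            (cechComapC2 B.X.hom B.X.hom (B.mulN 2).left (Over.w (B.mulN 2)) (fun j => (U j).1)
              (cechMapC2 B.X.hom πa _ oX)),
          refineMC2_mem_cechMZ2 B.X.hom _ _ W τ' hτ'
            (comapC2_mem_cechMZ2 B.X.hom B.X.hom (B.mulN 2).left (Over.w (B.mulN 2)) (fun j => (U j).1)
              (mapC2_mem_cechMZ2 B.X.hom πa _ hoXZ))⟩ =
      (2 : k) • CechMH2.mk B.X.hom (SheafOfModules.unit B.X.left.ringCatSheaf) W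
        ⟨cechMRefineC2 B.X.hom _ (fun j => (U' j).1) W τ' (fun s => (hτ' s).trans_eq (hU' (τ' s)).symm)
            (cechMapC2 B.X.hom πa _ oY),
          refineMC2_mem_cechMZ2 B.X.hom _ _ W τ' _ (mapC2_mem_cechMZ2 B.X.hom πa _ hoYZ)⟩ := by
  -- make `U' = [2]⁻¹U` definitional
  have hAff : ∀ j, IsAffineOpen ((B.mulN 2).left ⁻¹ᵁ (U j).1) := fun j => hU' j ▸ (U' j).2
  obtain rfl : U' = fun j => ⟨(B.mulN 2).left ⁻¹ᵁ (U j).1, hAff j⟩ := funext fun j => Subtype.ext (hU' j)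
  -- the dictionary: `π_a` is evaluation at a global `1`-form `ω`
  obtain ⟨ω, hπω⟩ := exists_oneForm_tangentSheaf_hom_app_eq_of_isLocalRing B hA πa
  -- `[2]^*ω = 2 • ω`
  have hω : (cotangentSheaf.comap (B.mulN 2)).app ⊤ ω =
      (show Γ(cotangentSheaf B.X, ⊤) from algebraMap k Γ(B.X.left, ⊤) (2 : k) • ω) := by
    have h := comap_mulN_app_top_algebraMap B 2 ω
    simpa only [Nat.cast_ofNat] using h
  -- B2 at `(f, ω', M) := ([2], ω, 2)`
  have hB2 := exists_cechMD1_eq_comap_obstruction_sub halg halg (B.mulN 2) J 𝔫' hJ hJ𝔫 h𝔫 e U b hb _ hU'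
    ψX hψX ψY hψY oX hoX oY hoY F hF hFψ ω ω (2 : k) hω
  exact slot3_rel1_of_B2 B U W τ' hτ' πa ω hπω oX hoXZ oY hoYZ hB2

end Literature.AlgebraicGeometry.AbelianSchemes.AbelianSchemeOver

end
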